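import Literature.AnabelianGeometry.EtaleTheta.Discharge.Sec4Model
import Literature.AnabelianGeometry.EtaleTheta.Discharge.Sec4Prop43iiHolds

/-!
# [EtTh] Prop 4.3 (iii) AS TYPED holds for EVERY canonical-model setting — `Φ` divisorial is not needed

Mochizuki, *The étale theta function and its Frobenioid-theoretic manifestations*, Publ. RIMS **45**
(2009), §4, Prop. 4.3 (iii) p.91 [cite: MochizukiEtTh2009, Prop 4.3 (iii) p.91]; Def. 3.6 (ii)(a) p.77.

abc-iut cell, block F, seat abc-iut-f-111 (tranche 111, FACT-LIST row F-1305 `BiKummerSetting.Prop43_iii`).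
PROOF-ONLY companion (no definition, no named fact, no instance).  The row is a SCHEMA over the abstract
setting `S : BiKummerSetting X T D VD`, whose birational vocabulary (`O^×(A^birat)`, `fracOf`, the
`Aut`-action) is FREE: its universal closure is refuted at a setting with trivial vocabulary and a
non-trivial Galois action (this seat's `ToyGal.not_forall_prop43_iii`, `Discharge/Sec4GaloisActionToy*.lean`).
The POSITIVE form that the §4 consumers instantiate is abc-iut-L6-t12's `prop43_iii_of` (any `S`, modulo
`Φ` divisorial, `B` group-like and the [FrdI] Thm. 5.2 (ii) dictionary `toB` with its laws `hfrac`, `haut`) and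
`prop43_iii_mkOfModel` (abc-iut-L2-t9's canonical model `mkOfModel`, where the dictionary is the identity;
modulo `Φ` divisorial).  THIS FILE removes the divisoriality hypothesis from both:

* `TemperedFrobenioid.eq_one_of_isUnit_of_of_eq_one` — a unit `u` of `Φ(A)` with `[u] = 0` in `Φ(A)^gp` is
  trivial (from this seat's `eq_one_of_isUnit_of_mul_eq`, p430175: `Φ^{bs-fld}(A)` is monoprime, Def. 3.6
  (ii)(a));
* `TemperedFrobenioid.unitsToRatFn_injective` — "the natural inclusion `O^×(A) ↪ O^×(A^birat) = B(A)`"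
  ([FrdI] Thm. 5.2 (ii); [EtTh] §5 p.331) is injective in EVERY tempered Frobenioid (abc-iut-L1's
  `ModelFrobenioid.unitsToRatFn_injective` asked for `Φ(A)` integral);
* `BiKummerRoot.sNum_mul_sDen_inv_pow_eq_one'`, `sNum_mul_sDen_inv_mem_mu'`, `prop43_iii_of_dictionary` —
  abc-iut-L6-t12's chain with `hΦd`, `hBg` discharged (only the dictionary `toB`, `hfrac`, `haut` remains);
* `prop43_iii_mkOfModel'` — **Prop. 4.3 (iii) as typed holds for EVERY `mkOfModel` setting, no residual
  hypothesis** (the REPAIRED, instance-level form of FACT-LIST row F-1305).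
HONEST FRAMING: [EtTh] is a published, refereed paper; typed (iii) is its first clause only (the comparison
with the Kummer class is TODO-merge(abc-iut-L1-t4) in `BiKummerRoots.lean`); nothing here asserts that such
data exist for an actual curve; no side taken on [IUTchIII] Cor. 3.12; typed ≠ proved except the theorems below.
-/

noncomputable section

namespace Literature.AnabelianGeometry.EtaleTheta

open CategoryTheory Opposite Literature.AlgebraicGeometry.Frobenioids
open Literature.AlgebraicGeometry.Frobenioids.PreFrobenioid (pull_inv_pull_eq pull_pull_inv_eq
  pull_injective)

universe u₀ v₀ u v w

/-! ### `O^×(A) ↪ B(A)` is injective in every tempered Frobenioid -/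

namespace TemperedFrobenioid

variable {D₀ : Type u₀} [Category.{v₀} D₀] {V : FrdIMonoidStub.{w}}
  {T : RealifiedDivisorMonoids (D₀ := D₀) V} {D : Type u} [Category.{v} D]
  {VD : FrdICatStub.{u, v, w} D} (C₀ : TemperedFrobenioid T D VD)

/-- A unit `u` of `Φ(A)` whose class in `Φ(A)^gp` is trivial is itself trivial: `[u] = 0` gives
`c · u = c` for some `c ∈ Φ(A)` (groupification = localisation), and a unit with a fixed point is `1`
(`eq_one_of_isUnit_of_mul_eq`: `Φ^{bs-fld}(A)` is monoprime, [EtTh] Def. 3.6 (ii)(a)).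
[cite: MochizukiEtTh2009, Def 3.6 p.77] -/
theorem eq_one_of_isUnit_of_of_eq_one (A : Dᵒᵖ) {u : C₀.Φ.carrier A} (hu : IsUnit u)
    (h : Algebra.GrothendieckGroup.of u = 1) : u = 1 := by
  obtain ⟨c, hc⟩ := (Localization.monoidOf (⊤ : Submonoid (C₀.Φ.carrier A))).eq_iff_exists.1
    (h.trans (map_one (Algebra.GrothendieckGroup.of (M := C₀.Φ.carrier A))).symm)
  rw [mul_one] at hc
  exact C₀.eq_one_of_isUnit_of_mul_eq A hu (z := (c : C₀.Φ.carrier A)) (by rw [mul_comm]; exact hc)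

/-- **"The natural inclusion `O^×(A) ↪ O^×(A^birat)`" is injective in EVERY tempered Frobenioid** ([FrdI]
Thm. 5.2 (ii): `O^×(−)` of `C^birat` is `B`; [EtTh] §5 p.331): a base-identity linear automorphism of the model
Frobenioid is determined by its rational function — its zero divisor is a unit of `Φ(A)` with the same class
as the rational function's divisor, hence determined (`eq_one_of_isUnit_of_of_eq_one`); no integrality of
`Φ(A)` needed. [cite: MochizukiEtTh2009, §5 p.331 (PDF p.105)] -/
theorem unitsToRatFn_injective (X : C₀.category) : Function.Injective (ModelFrobenioid.unitsToRatFn X) := by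
  intro α β h
  have hu : ModelFrobenioid.unit α.1.hom = ModelFrobenioid.unit β.1.hom := by
    rw [← ModelFrobenioid.coe_unitsToRatFn, ← ModelFrobenioid.coe_unitsToRatFn, h]
  have hα := ModelFrobenioid.div_inv_mul_div_of_mem_units α.2
  have hβ := ModelFrobenioid.div_inv_mul_div_of_mem_units β.2
  have hrelα := ModelFrobenioid.of_div_eq_divB_unit_of_mem_units α.2
  have hrelβ := ModelFrobenioid.of_div_eq_divB_unit_of_mem_units β.2
  -- the unit `v := Div(α) · Div(β⁻¹)` has trivial class
  have hv : IsUnit (ModelFrobenioid.div α.1.hom * ModelFrobenioid.div β.1.inv) :=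
    (IsUnit.of_mul_eq_one_right _ hα.1).mul (IsUnit.of_mul_eq_one _ hβ.1)
  have hvof : Algebra.GrothendieckGroup.of (ModelFrobenioid.div α.1.hom * ModelFrobenioid.div β.1.inv) = 1 := by
    have e : Algebra.GrothendieckGroup.of (ModelFrobenioid.div β.1.inv) *
        Algebra.GrothendieckGroup.of (ModelFrobenioid.div β.1.hom) = 1 := by
      rw [← map_mul, hβ.1, map_one]
    rw [map_mul, hrelα, hu, ← hrelβ, mul_comm]
    exact e
  have hv1 := C₀.eq_one_of_isUnit_of_of_eq_one (op X.base) hv hvof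
  have hdiv : ModelFrobenioid.div α.1.hom = ModelFrobenioid.div β.1.hom := by
    have hv1' : ModelFrobenioid.div α.1.hom * ModelFrobenioid.div β.1.inv =
        (1 : C₀.divisorMonoid.obj (op X.base)) := hv1
    calc ModelFrobenioid.div α.1.hom
        = ModelFrobenioid.div α.1.hom * (ModelFrobenioid.div β.1.inv * ModelFrobenioid.div β.1.hom) := by
          rw [hβ.1, mul_one]
      _ = (ModelFrobenioid.div α.1.hom * ModelFrobenioid.div β.1.inv) * ModelFrobenioid.div β.1.hom :=
          (mul_assoc _ _ _).symm
      _ = ModelFrobenioid.div β.1.hom := by rw [hv1', one_mul]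
  apply Subtype.ext
  apply Aut.ext
  exact ModelFrobenioid.hom_ext (by rw [α.2.2, β.2.2]) (by rw [α.2.1, β.2.1]) hdiv hu

end TemperedFrobenioid

/-! ### Proposition 4.3 (iii) without `Φ` divisorial -/

variable {K : Type u₀} [Field K]

namespace BiKummerSetting

variable {X : SemiGraphs.TemperedArithmeticGroup.{u₀} K} {D₀ : Type u₀} [Category.{v₀} D₀]
  {V : FrdIMonoidStub.{w}} {T : RealifiedDivisorMonoids (D₀ := D₀) V} {D : Type u} [Category.{v} D]
  {VD : FrdICatStub.{u, v, w} D} {S : BiKummerSetting X T D VD}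

namespace BiKummerRoot

variable {A B : S.C} {f : S.biratUnits A} {P : S.FractionPair f B} {N : ℕ+}
  {pullFrac : ∀ {A A' : S.C} (_ : A' ⟶ A), S.biratUnits A → S.biratUnits A'}
  {R : S.NthRoot f P N pullFrac} {hA : S.IsGalois R.AN} {hB : S.IsGalois R.BN}
  (K : S.BiKummerRoot R hA hB)

/-- **Prop. 4.3 (iii), `N`-torsion, in EVERY setting carrying the [FrdI] Thm. 5.2 (ii) dictionary**:
`(s'^{gp}(h) · s''^{gp}(h)⁻¹)^N = 1` — abc-iut-L6-t12's `sNum_mul_sDen_inv_pow_eq_one` with `Φ` divisorial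
and `B` group-like DISCHARGED (`B` group-like: `ratFnFunctor_isGroupLike_holds`; the final step
"`O^×(B_N) ↪ B(B_N)^×`" by `TemperedFrobenioid.unitsToRatFn_injective`).  The dictionary `toB` with its laws
`hfrac` (it computes the fraction `s' · (s'')⁻¹`) and `haut` (compatibility with the `Aut_C(A)`-action) remains.
[cite: MochizukiEtTh2009, Prop 4.3(iii) p.91] -/
theorem sNum_mul_sDen_inv_pow_eq_one'
    (toB : ∀ A : S.C, S.biratUnits A →* (S.tf.ratFnFunctor.obj (op A.base))ˣ)
    (hfrac : ∀ {A B : S.C} (s' s'' : A ⟶ B) (h' : S.IsPreStep s') (h'' : S.IsPreStep s'')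
      (hb : PreFrobenioid.BaseEquivalent S.F s' s''),
      (toB A (S.fracOf s' s'' h' h'' hb) : S.tf.ratFnFunctor.obj (op A.base)) *
        ModelFrobenioid.unit s'' = ModelFrobenioid.unit s')
    (haut : ∀ {A : S.C} (σ : Aut A) (x : S.biratUnits A),
      (toB A (S.biratAut A σ x) : S.tf.ratFnFunctor.obj (op A.base)) =
        pull S.tf.ratFnFunctor (ModelFrobenioid.baseMap σ.inv) (toB A x : S.tf.ratFnFunctor.obj (op A.base)))
    (h : S.HA R.BN hB) : (K.sNum h * (K.sDen h)⁻¹) ^ (N : ℕ) = 1 := by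
  have hBg : Objectwise (fun M _ => IsGroupLike M) S.tf.ratFnFunctor := S.tf.ratFnFunctor_isGroupLike_holds
  have hstriv : K.striv (K.ident.symm h) ∈ S.HA R.AN hA := striv_mem S K (K.ident.symm h)
  haveI : IsCancelMul (S.tf.ratFnFunctor.obj (op R.AN.base)) :=
    isIntegral_iff_isCancelMul.mp (hBg R.AN.base).isPreDivisorial.isIntegral
  haveI : IsCancelMul (S.tf.ratFnFunctor.obj (op R.BN.base)) :=
    isIntegral_iff_isCancelMul.mp (hBg R.BN.base).isPreDivisorial.isIntegral
  haveI : IsIso (ModelFrobenioid.baseMap R.pair.num) := R.pair.isPreStep_num.2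
  set τ := K.striv (K.ident.symm h) with hτ
  -- the Kummer-cocycle identity and its `N`-th power
  have E := K.pull_unit_sNum_mul_root hBg toB hfrac h
  have hxN : (toB R.AN R.root : S.tf.ratFnFunctor.obj (op R.AN.base)) ^ (N : ℕ) =
      (toB R.AN (pullFrac R.αData.α₁ f) : S.tf.ratFnFunctor.obj (op R.AN.base)) := by
    rw [← Units.val_pow_eq_pow_val, ← map_pow, R.pow_root]
  have hfix : pull S.tf.ratFnFunctor (ModelFrobenioid.baseMap τ.hom)
      (toB R.AN (pullFrac R.αData.α₁ f) : S.tf.ratFnFunctor.obj (op R.AN.base)) =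
      (toB R.AN (pullFrac R.αData.α₁ f) : S.tf.ratFnFunctor.obj (op R.AN.base)) := by
    have hmem : τ⁻¹ ∈ S.HA R.AN hA := Subgroup.inv_mem _ hstriv
    have e : (toB R.AN (S.biratAut R.AN τ⁻¹ (pullFrac R.αData.α₁ f)) : S.tf.ratFnFunctor.obj (op R.AN.base)) =
        (toB R.AN (pullFrac R.αData.α₁ f) : S.tf.ratFnFunctor.obj (op R.AN.base)) :=
      congrArg (fun y : S.biratUnits R.AN => (toB R.AN y : S.tf.ratFnFunctor.obj (op R.AN.base)))
        (R.isSaturated.fixed τ⁻¹ hmem)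
    rwa [haut] at e
  have EN := congrArg (fun y => y ^ (N : ℕ)) E
  simp only [mul_pow] at EN
  rw [← map_pow, ← map_pow, ← map_pow, hxN, hfix, mul_comm _ (toB R.AN (pullFrac R.αData.α₁ f) :
    S.tf.ratFnFunctor.obj (op R.AN.base))] at EN
  have hpow : ModelFrobenioid.unit (K.sNum h).hom ^ (N : ℕ) = ModelFrobenioid.unit (K.sDen h).hom ^ (N : ℕ) := by
    apply pull_injective (ModelFrobenioid.baseMap R.pair.num)
    exact mul_left_cancel EN
  -- the rational function of `w = s'(h) · s''(h)⁻¹` and of `w^N`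
  have hw : K.sNum h * (K.sDen h)⁻¹ ∈ S.units R.BN := K.sNum_mul_sDen_inv_mem_units h
  let w' : ModelFrobenioid.units R.BN := ⟨K.sNum h * (K.sDen h)⁻¹, hw⟩
  have hu : ModelFrobenioid.unit (K.sNum h * (K.sDen h)⁻¹).hom *
      pull S.tf.ratFnFunctor (ModelFrobenioid.baseMap (K.sDen h).inv) (ModelFrobenioid.unit (K.sDen h).hom) =
      pull S.tf.ratFnFunctor (ModelFrobenioid.baseMap (K.sDen h).inv) (ModelFrobenioid.unit (K.sNum h).hom) := by
    have e0 := congrArg ModelFrobenioid.unit (K.sDen h).inv_hom_id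
    rw [ModelFrobenioid.unit_comp_of_degFr_eq_one _ (ModelFrobenioid.degFr_eq_one_of_isIso _),
      ModelFrobenioid.unit_id] at e0
    change ModelFrobenioid.unit ((K.sDen h).inv ≫ (K.sNum h).hom) * _ = _
    rw [ModelFrobenioid.unit_comp_of_degFr_eq_one _ (ModelFrobenioid.degFr_eq_one_of_isIso _), mul_assoc,
      mul_comm (ModelFrobenioid.unit (K.sDen h).inv), e0, mul_one]
  have huN : ModelFrobenioid.unit (K.sNum h * (K.sDen h)⁻¹).hom ^ (N : ℕ) = 1 := by
    have e := congrArg (fun y => y ^ (N : ℕ)) hu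
    simp only [mul_pow] at e
    rw [← map_pow, ← map_pow, hpow] at e
    exact mul_right_cancel (e.trans (one_mul _).symm)
  -- `O^×(B_N) ↪ B(Base B_N)^×` is injective in every tempered Frobenioid: `w^N = 1`
  have key : ModelFrobenioid.unitsToRatFn R.BN (w' ^ (N : ℕ)) = ModelFrobenioid.unitsToRatFn R.BN 1 := by
    rw [map_pow, map_one]
    apply Units.ext
    rw [Units.val_pow_eq_pow_val, ModelFrobenioid.coe_unitsToRatFn, Units.val_one]
    exact huN
  have hwN := S.tf.unitsToRatFn_injective R.BN key
  simpa [w'] using congrArg Subtype.val hwN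

/-- **[EtTh] Prop. 4.3 (iii), first clause**, for ONE bi-Kummer root, modulo the dictionary only.
[cite: MochizukiEtTh2009, Prop 4.3(iii) p.91] -/
theorem sNum_mul_sDen_inv_mem_mu'
    (toB : ∀ A : S.C, S.biratUnits A →* (S.tf.ratFnFunctor.obj (op A.base))ˣ)
    (hfrac : ∀ {A B : S.C} (s' s'' : A ⟶ B) (h' : S.IsPreStep s') (h'' : S.IsPreStep s'')
      (hb : PreFrobenioid.BaseEquivalent S.F s' s''),
      (toB A (S.fracOf s' s'' h' h'' hb) : S.tf.ratFnFunctor.obj (op A.base)) *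
        ModelFrobenioid.unit s'' = ModelFrobenioid.unit s')
    (haut : ∀ {A : S.C} (σ : Aut A) (x : S.biratUnits A),
      (toB A (S.biratAut A σ x) : S.tf.ratFnFunctor.obj (op A.base)) =
        pull S.tf.ratFnFunctor (ModelFrobenioid.baseMap σ.inv) (toB A x : S.tf.ratFnFunctor.obj (op A.base)))
    (h : S.HA R.BN hB) : K.sNum h * (K.sDen h)⁻¹ ∈ S.mu R.BN N :=
  ⟨K.sNum_mul_sDen_inv_mem_units h, K.sNum_mul_sDen_inv_pow_eq_one' toB hfrac haut h⟩

end BiKummerRoot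

/-- **[EtTh] Prop. 4.3 (iii) as typed, modulo the [FrdI] Thm. 5.2 (ii) dictionary ONLY** (every setting `S`;
`Φ` divisorial and `B` group-like discharged from abc-iut-L6-t12's `prop43_iii_of`).
[cite: MochizukiEtTh2009, Prop 4.3(iii) p.91] -/
theorem prop43_iii_of_dictionary (pullFrac : ∀ {A A' : S.C} (_ : A' ⟶ A), S.biratUnits A → S.biratUnits A')
    (toB : ∀ A : S.C, S.biratUnits A →* (S.tf.ratFnFunctor.obj (op A.base))ˣ)
    (hfrac : ∀ {A B : S.C} (s' s'' : A ⟶ B) (h' : S.IsPreStep s') (h'' : S.IsPreStep s'')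
      (hb : PreFrobenioid.BaseEquivalent S.F s' s''),
      (toB A (S.fracOf s' s'' h' h'' hb) : S.tf.ratFnFunctor.obj (op A.base)) *
        ModelFrobenioid.unit s'' = ModelFrobenioid.unit s')
    (haut : ∀ {A : S.C} (σ : Aut A) (x : S.biratUnits A),
      (toB A (S.biratAut A σ x) : S.tf.ratFnFunctor.obj (op A.base)) =
        pull S.tf.ratFnFunctor (ModelFrobenioid.baseMap σ.inv) (toB A x : S.tf.ratFnFunctor.obj (op A.base))) :
    S.Prop43_iii pullFrac :=
  fun _ _ _ K h => K.sNum_mul_sDen_inv_mem_mu' toB hfrac haut h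

/-- **[EtTh] Prop. 4.3 (iii) as typed holds for EVERY canonical-model setting `mkOfModel`, with NO residual
hypothesis** — the repaired, instance-level form of FACT-LIST row F-1305: abc-iut-L6-t12's
`prop43_iii_mkOfModel` with `Φ` divisorial discharged (the dictionary of `mkOfModel` is the identity, its laws
are abc-iut-L2-t9's `coe_fracOfModel_mul_unit` / `coe_biratAutModel_eq_pull`).
[cite: MochizukiEtTh2009, Prop 4.3(iii) p.91] -/
theorem prop43_iii_mkOfModel' (tf : TemperedFrobenioid T D VD) (hZ : tf.monoidType = MonoidType.Z)
    (hP : ∀ A : Dᵒᵖ, IsPerfect (tf.Φ.carrier A)) (hBΛ : ∀ (Y : D₀ᵒᵖ) (b : T.BΛ.obj Y), IsUnit b)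
    (DS : ∀ {A : Dᵒᵖ}, tf.Φ.carrier A → tf.Φ.carrier A → Prop) (IG : D → Prop)
    (gS : ∀ A : D, IG A → (X.Pi →* Aut A)) (gSs : ∀ (A : D) (h : IG A), Function.Surjective (gS A h))
    (NH : Subgroup (Field.absoluteGaloisGroup K) → tf.category → ℕ+ → Prop)
    (AB : ∀ {A B : tf.category}, Subgroup (Aut A) → (A ⟶ A) → (A ⟶ B) → Prop) (A₀ : tf.category)
    (hA₀ : PreFrobenioid.IsFrobeniusTrivial tf.toElem A₀) (hA₀' : IG A₀.base)
    (pullFrac : ∀ {A A' : tf.category} (_ : A' ⟶ A), tf.biratUnitsModel A → tf.biratUnitsModel A') :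
    (mkOfModel X tf hZ hP hBΛ DS IG gS gSs NH AB A₀ hA₀ hA₀').Prop43_iii pullFrac := by
  intro A B f P N R hA hB K h
  refine K.sNum_mul_sDen_inv_mem_mu' (fun A => MonoidHom.id (tf.biratUnitsModel A)) ?_ ?_ h
  · intro A B s' s'' h' h'' hb
    exact coe_fracOfModel_mul_unit tf hBΛ s' s''
  · intro A σ x
    exact coe_biratAutModel_eq_pull tf σ x

end BiKummerSetting

end Literature.AnabelianGeometry.EtaleTheta

end
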